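import Summits.CriticalPhenomena.SAWScalingLimit.Theorems.SAWSpinMonotoneQCIdentificationNoBranchingArcLift
import Summits.CriticalPhenomena.SAWScalingLimit.Theorems.SAWSpinMonotoneQCIdentificationNoBranchingTelescope
import Summits.CriticalPhenomena.SAWScalingLimit.Theorems.SAWSpinMonotoneQCIdentificationNoBranchingHexagon
import Summits.CriticalPhenomena.SAWScalingLimit.Theorems.SAWSpinMonotoneQCIdentificationNoCollapse

/-!
# `NoBranching` — the combinatorial Gauss–Bonnet assembly (the registered stub
`stub_noBranching : NoFoldBound → NoBranching` of line `eight_fifths_primitive`, crux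
`QCIdentification`, stmt-CriticalPhenomena-16772)

**What.** `theorem stub_noBranching : NoFoldBound → NoBranching`: under the no-fold bound (K), for
every simply connected hexagonal domain `Λ`, boundary source `a` and site `x` of `𝕋` whose six faces
lie in `Λ` with non-zero `∂H`-modes `S_j`, the typed sum `Σ_j arg (S_{j+1}/S_j)` vanishes — the
piecewise-affine developing map has local degree ONE at every interior hexagon.

**Proof (steps S1–S7 of the stub report, all ingredients landed in the sibling files).** Write
`a = {u_a, v_a}` (`v_a ∈ Λ`, `u_a ∉ Λ`) and let `Λ₀ = srcComp Λ v_a` be the SOURCE COMPONENT, the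
vertices of `Λ` joined to `v_a` inside `Λ`. On `Λ₀` every `∂H`-mode is non-zero (no collapse,
`Dev.modeSum_ne_zero_of_reachable`), conversely a face with non-zero mode lies in `Λ₀` (its port
values are carried by walks from `a`, `mem_srcComp_of_modeSum_ne_zero`), so the hexagon of `x` lies in
`Λ₀`, and `Λ₀` is closed under `Λ`-adjacency, so its missing neighbours are missing from `Λ`.
(1) Face sum (S1/S3): every image triangle of `Λ₀` has corner angles summing to `π`
(`NB.sum_cornerAngle_eq_pi`), so `Σ_{v ∈ Λ₀} Σ_k (β_v(k) - π/3) = 0`. (2) Regroup the corners by site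
(`Stokes.st_sum_corners_split`): interior sites of `Λ₀` (full hexagons) plus boundary sites.
(3) At an interior site the six corner angles sum to `2π +` typed sum (S2, `NB.hexagon_corner_sum`),
and the typed sum is `2π n`, `n : ℕ` (`NB.typedSum_nonneg_int`): interior contribution
`Σ_s typedSum(s)`, every term `≥ 0`. (4) At a boundary site the faces present split into arcs
(`NB.s7_sum_runs`); along an arc of length `m` the corner angles sum to
`m·π/3 + (5/8)(W(p_out) - W(p_in)) + 2πn`, `n : ℕ` (S4–S6, the real lift `NB.arc_lift`), and the
flank windings telescope over all arcs (`NB.sum_flank_sub_eq_zero`), so the boundary contribution is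
`≥ 0` (`bdry_excess_nonneg`). (5) Hence `Σ_{s interior} typedSum(s) ≤ 0` with non-negative terms:
every typed sum vanishes, in particular at `x`. ∎

Sources: H. Duminil-Copin, S. Smirnov, *The connective constant of the honeycomb lattice equals
`√(2+√2)`*, Ann. of Math. 175 (2012) 1653–1665 (arXiv:1007.0575), Lemma 1 and §3; the angle-sum /
degree count for piecewise linear maps is folklore (discrete Gauss–Bonnet); the stub report
`STUB-REPORT-noBranching.md` of this line (§2).
-/

noncomputable section

open Complex
open Literature.Probability.LatticeModels Literature.Probability.RandomPlanarGeometry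
open Literature.Probability.RandomPlanarGeometry.SAW
open Literature.Barriers.CriticalPhenomena Literature.Barriers.CriticalPhenomena.HexKernel
open Summit.CriticalPhenomena.SAWScalingLimit.Theses.SAWDevelopingMap

namespace Summit.CriticalPhenomena.SAWScalingLimit.Cruxes.QCIdentification.EightFifthsPrimitive

namespace NB

open Stokes

/-! ### The source component -/

open Classical in
/-- The **source component**: the vertices of `Λ` joined to `va` inside `Λ` (empty if `va ∉ Λ`). -/
def srcComp (Λ : Finset HexVertex) (va : HexVertex) : Finset HexVertex :=
  Λ.filter fun v => ∃ (hva : va ∈ Λ) (hv : v ∈ Λ),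
    (hexGraph.induce (Λ : Set HexVertex)).Reachable ⟨va, hva⟩ ⟨v, hv⟩

variable {Λ : Finset HexVertex} {ua va : HexVertex}

/-- Membership in the source component. -/
theorem mem_srcComp_iff {v : HexVertex} : v ∈ srcComp Λ va ↔
    ∃ (hva : va ∈ Λ) (hv : v ∈ Λ), (hexGraph.induce (Λ : Set HexVertex)).Reachable ⟨va, hva⟩ ⟨v, hv⟩ := by
  simp only [srcComp, Finset.mem_filter, and_iff_right_iff_imp]
  rintro ⟨-, hv, -⟩
  exact hv

/-- The source component lies in `Λ`. -/
theorem srcComp_subset {v : HexVertex} (hv : v ∈ srcComp Λ va) : v ∈ Λ :=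
  (Finset.mem_filter.1 hv).1

/-- **The source component is closed under `Λ`-adjacency.** -/
theorem mem_srcComp_of_adj {v w : HexVertex} (hv : v ∈ srcComp Λ va) (hw : w ∈ Λ)
    (hadj : hexGraph.Adj v w) : w ∈ srcComp Λ va := by
  obtain ⟨hva, hvΛ, hr⟩ := mem_srcComp_iff.1 hv
  refine mem_srcComp_iff.2 ⟨hva, hw, hr.trans (SimpleGraph.Adj.reachable ?_)⟩
  exact SimpleGraph.induce_adj.2 hadj

/-- Hence a neighbour missing from the source component is missing from `Λ`. -/
theorem not_mem_of_not_mem_srcComp {v w : HexVertex} (hv : v ∈ srcComp Λ va)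
    (hadj : hexGraph.Adj v w) (hw : w ∉ srcComp Λ va) : w ∉ Λ :=
  fun hwΛ => hw (mem_srcComp_of_adj hv hwΛ hadj)

/-- **No collapse on the source component** (under (K)): every `∂H`-mode there is non-zero. -/
theorem modeSum_ne_zero_of_mem_srcComp (hK : NoFoldBound) (hΛ : hexDomainSimplyConnected Λ)
    (hua : ua ∉ Λ) (hadj : hexGraph.Adj va ua) {v : HexVertex} (hv : v ∈ srcComp Λ va) :
    modeSum (Fobs Λ s(ua, va)) v ≠ 0 := by
  obtain ⟨hva, hvΛ, hr⟩ := mem_srcComp_iff.1 hv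
  exact Dev.modeSum_ne_zero_of_reachable hK hΛ (mk_mem_boundary hva hua hadj)
    (Sym2.mem_mk_right ua va) hva hvΛ hr

/-- **Conversely, non-degenerate faces lie in the source component**: a non-zero `∂H`-mode has a
non-zero port value, carried by a walk from `a`, which joins the face to `va` inside `Λ`. -/
theorem mem_srcComp_of_modeSum_ne_zero (hva : va ∈ Λ) (hua : ua ∉ Λ) {v : HexVertex} (hv : v ∈ Λ)
    (hS : modeSum (Fobs Λ s(ua, va)) v ≠ 0) : v ∈ srcComp Λ va := by
  have h : ∃ k : Fin 3, Fobs Λ s(ua, va) s(v, hexNbr v k) ≠ 0 := by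
    by_contra h
    push Not at h
    exact hS (by simp [modeSum, h])
  obtain ⟨k, hk⟩ := h
  obtain ⟨γ⟩ := nonempty_saw_of_fobs_ne_zero hk
  refine mem_srcComp_iff.2 ⟨hva, hv, ?_⟩
  by_cases hne : γ.verts = []
  · -- the trivial walk: the port is the source itself, `v = va`
    rcases Sym2.eq_iff.1 (γ.eq_of_nil hne) with ⟨h1, -⟩ | ⟨-, h2⟩
    · subst h1
      exact absurd hv hua
    · subst h2
      exact SimpleGraph.Reachable.refl _
  · have hmem : γ.verts.getLast hne ∈ γ.verts := List.getLast_mem hne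
    have hzΛ : γ.verts.getLast hne ∈ Λ := γ.subset _ hmem
    have hr := reachable_of_saw hua hva γ hne hmem hzΛ
    rcases γ.getLast_eq_or hne with h | h
    · have e : (⟨γ.verts.getLast hne, hzΛ⟩ : (Λ : Set HexVertex)) = ⟨v, hv⟩ := Subtype.ext h
      rwa [e] at hr
    · have hwΛ : hexNbr v k ∈ Λ := h ▸ hzΛ
      have e : (⟨γ.verts.getLast hne, hzΛ⟩ : (Λ : Set HexVertex)) = ⟨hexNbr v k, hwΛ⟩ :=
        Subtype.ext h
      rw [e] at hr
      refine hr.trans (SimpleGraph.Adj.reachable ?_)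
      exact SimpleGraph.induce_adj.2 (adj_hexNbr v k).symm

/-! ### The face sum -/

/-- **(1) The face sum**: on the source component every image triangle has corner angles summing to
`π`, so `Σ_{v ∈ Λ₀} Σ_k (β_v(k+2) - π/3) = 0` (corners shifted by two for the site regrouping). -/
theorem sum_faces_cornerAngle_sub (hK : NoFoldBound) (hΛ : hexDomainSimplyConnected Λ)
    (hva : va ∈ Λ) (hua : ua ∉ Λ) (hadj : hexGraph.Adj va ua) :
    ∑ v ∈ srcComp Λ va, ∑ k : Fin 3, (cornerAngle (Fobs Λ s(ua, va)) v (k + 2) - Real.pi / 3) = 0 := by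
  refine Finset.sum_eq_zero fun v hv => ?_
  have hπ := sum_cornerAngle_eq_pi hK hΛ (mk_mem_boundary hva hua hadj) (srcComp_subset hv)
    (modeSum_ne_zero_of_mem_srcComp hK hΛ hua hadj hv)
  have hre : ∑ k : Fin 3, cornerAngle (Fobs Λ s(ua, va)) v (k + 2) =
      ∑ k : Fin 3, cornerAngle (Fobs Λ s(ua, va)) v k :=
    Fintype.sum_equiv (Equiv.addRight 2) _ _ (fun _ => rfl)
  rw [Finset.sum_sub_distrib, hre, hπ, Finset.sum_const, Finset.card_univ, Fintype.card_fin,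
    nsmul_eq_mul]
  push_cast
  ring

/-! ### The boundary excess is non-negative -/

/-- **(4a) One arc.** At a boundary site `s` of the source component `Λ₀`, along the arc with pre-flank
`j` (length `m = runLen`), the angle excess `Σ_{i<m} (β - π/3)` is at least `(5/8)(W(p_out) - W(p_in))`
(it equals this plus `2πn`, `n : ℕ`, by the real lift `NB.arc_lift`, the arc being a genuine arc of
`Λ`: its faces lie in `Λ₀ ⊆ Λ` with non-zero modes, its flanks are `Λ`-neighbours of faces of `Λ₀`
outside `Λ₀`, hence outside `Λ`). -/
theorem run_excess_ge (hK : NoFoldBound) (hΛ : hexDomainSimplyConnected Λ)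
    (hva : va ∈ Λ) (hua : ua ∉ Λ) (hadj : hexGraph.Adj va ua) {s : Site 2}
    (hs : s ∈ bdrySites (srcComp Λ va)) {j : Fin 6} (hj : j ∈ runStarts (siteFaces (srcComp Λ va) s)) :
    (5 / 8 : ℝ) * (bdryWinding Λ s(ua, va) s(face s j, face s (j + 1)) -
        bdryWinding Λ s(ua, va) s(face s (j + 1 + runLen (siteFaces (srcComp Λ va) s) j),
          face s (j + runLen (siteFaces (srcComp Λ va) s) j))) ≤
      ∑ i ∈ Finset.univ.filter (fun i : Fin 6 => i < runLen (siteFaces (srcComp Λ va) s) j),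
        (cornerAngle (Fobs Λ s(ua, va)) (face s (j + 1 + i)) (arcCornerIdx (j + 1 + i)) - Real.pi / 3) := by
  have hJ : siteFaces (srcComp Λ va) s ≠ Finset.univ := siteFaces_ne_univ (Finset.mem_filter.1 hs).2
  obtain ⟨hj0, hj1⟩ := mem_runStarts.1 hj
  rw [mem_siteFaces] at hj0 hj1
  have hout : face s j ∉ Λ :=
    not_mem_of_not_mem_srcComp hj1 (by simpa using StepLaw.adj_face_pred s (j + 1)) hj0
  have hin0 : ∀ i : Fin 6, i < runLen (siteFaces (srcComp Λ va) s) j →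
      face s (j + 1 + i) ∈ srcComp Λ va :=
    fun i hi => mem_siteFaces.1 (mem_of_lt_runLen _ j hj i hi)
  have hin : ∀ i : Fin 6, i < runLen (siteFaces (srcComp Λ va) s) j → face s (j + 1 + i) ∈ Λ :=
    fun i hi => srcComp_subset (hin0 i hi)
  have hS : ∀ i : Fin 6, i < runLen (siteFaces (srcComp Λ va) s) j →
      modeSum (Fobs Λ s(ua, va)) (face s (j + 1 + i)) ≠ 0 :=
    fun i hi => modeSum_ne_zero_of_mem_srcComp hK hΛ hua hadj (hin0 i hi)
  have hlast : face s (j + runLen (siteFaces (srcComp Λ va) s) j) ∈ srcComp Λ va :=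
    mem_siteFaces.1 (add_runLen_mem _ j hj)
  have hout'0 : face s (j + 1 + runLen (siteFaces (srcComp Λ va) s) j) ∉ srcComp Λ va :=
    fun h => add_one_add_runLen_not_mem _ hJ j hj (mem_siteFaces.2 h)
  have hadj' : hexGraph.Adj (face s (j + runLen (siteFaces (srcComp Λ va) s) j))
      (face s (j + 1 + runLen (siteFaces (srcComp Λ va) s) j)) := by
    have h := StepLaw.adj_face_succ s (j + runLen (siteFaces (srcComp Λ va) s) j)
    rwa [show j + runLen (siteFaces (srcComp Λ va) s) j + 1 =
      j + 1 + runLen (siteFaces (srcComp Λ va) s) j by abel] at h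
  have hout' : face s (j + 1 + runLen (siteFaces (srcComp Λ va) s) j) ∉ Λ :=
    not_mem_of_not_mem_srcComp hlast hadj' hout'0
  obtain ⟨n, hn⟩ := arc_lift hK hΛ (mk_mem_boundary hva hua hadj) s j _ (runLen_ne_zero _ j)
    hout hin hout' hS
  rw [Finset.sum_sub_distrib, hn, Finset.sum_const, card_filter_lt, nsmul_eq_mul]
  have h2 : (0 : ℝ) ≤ 2 * Real.pi * n := by positivity
  linarith

/-- **(4) The boundary excess is non-negative**: summed over the boundary sites of the source
component, the angle excesses `β - π/3` of the corners present are `≥ 0` (run decomposition, the arc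
bound `run_excess_ge`, and the telescoping `NB.sum_flank_sub_eq_zero` of the flank windings). -/
theorem bdry_excess_nonneg (hK : NoFoldBound) (hΛ : hexDomainSimplyConnected Λ)
    (hva : va ∈ Λ) (hua : ua ∉ Λ) (hadj : hexGraph.Adj va ua) :
    0 ≤ ∑ s ∈ (cornerSites (srcComp Λ va)).filter
        (fun s => ¬ ∀ j : Fin 6, HexKernel.face s j ∈ srcComp Λ va),
      ∑ j : Fin 6, (if HexKernel.face s j ∈ srcComp Λ va then
        cornerAngle (Fobs Λ s(ua, va)) (HexKernel.face s j) (arcCornerIdx j) - Real.pi / 3 else 0) := by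
  have htel := sum_flank_sub_eq_zero (srcComp Λ va) (bdryWinding Λ s(ua, va))
  have hite : ∀ s : Site 2, (∑ j : Fin 6, if HexKernel.face s j ∈ srcComp Λ va then
      cornerAngle (Fobs Λ s(ua, va)) (HexKernel.face s j) (arcCornerIdx j) - Real.pi / 3 else 0) =
      ∑ j ∈ siteFaces (srcComp Λ va) s,
        (cornerAngle (Fobs Λ s(ua, va)) (face s j) (arcCornerIdx j) - Real.pi / 3) := by
    intro s
    rw [siteFaces, Finset.sum_filter]
  show 0 ≤ ∑ s ∈ bdrySites (srcComp Λ va), _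
  simp only [hite]
  calc (0 : ℝ) = ∑ s ∈ bdrySites (srcComp Λ va), ∑ j ∈ runStarts (siteFaces (srcComp Λ va) s),
      (5 / 8 : ℝ) * (bdryWinding Λ s(ua, va) s(face s j, face s (j + 1)) -
        bdryWinding Λ s(ua, va) s(face s (j + 1 + runLen (siteFaces (srcComp Λ va) s) j),
          face s (j + runLen (siteFaces (srcComp Λ va) s) j))) := by
        simp only [← Finset.mul_sum]
        rw [htel, mul_zero]
    _ ≤ _ := Finset.sum_le_sum fun s hs => ?_
  rw [s7_sum_runs (siteFaces (srcComp Λ va) s) (siteFaces_ne_univ (Finset.mem_filter.1 hs).2)]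
  exact Finset.sum_le_sum fun j hj => run_excess_ge hK hΛ hva hua hadj hs hj

/-! ### The assembly -/

/-- **`NoBranching` from the no-fold bound** (the Gauss–Bonnet count). -/
theorem noBranching_of_noFoldBound (hK : NoFoldBound) : NoBranching := by
  intro Λ hΛ a ha x hx hSx
  obtain ⟨haE, ua, va, rfl, hva, hua⟩ := id ha
  have hadj : hexGraph.Adj va ua := ((SimpleGraph.mem_edgeSet hexGraph).1 haE).symm
  have hx0 : ∀ j : Fin 6, face x j ∈ srcComp Λ va :=
    fun j => mem_srcComp_of_modeSum_ne_zero hva hua (hx j) (hSx j)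
  -- (1)+(2): the face sum vanishes and splits into interior and boundary sites
  have hsplit := st_sum_corners_split (srcComp Λ va)
    (fun v k => cornerAngle (Fobs Λ s(ua, va)) v (k + 2) - Real.pi / 3)
  simp only [siteCornerIdx_add_two] at hsplit
  rw [sum_faces_cornerAngle_sub hK hΛ hva hua hadj] at hsplit
  -- (3): interior sites carry the typed sums, each `2π n ≥ 0`
  have hint : ∀ s ∈ (cornerSites (srcComp Λ va)).filter
      (fun s => ∀ j : Fin 6, HexKernel.face s j ∈ srcComp Λ va),
      ∑ j : Fin 6, (cornerAngle (Fobs Λ s(ua, va)) (face s j) (arcCornerIdx j) - Real.pi / 3) =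
        ∑ j : Fin 6, arg (modeSum (Fobs Λ s(ua, va)) (face s (j + 1)) /
          modeSum (Fobs Λ s(ua, va)) (face s j)) := by
    intro s hs
    have hs6 := (Finset.mem_filter.1 hs).2
    have h2 := hexagon_corner_sum hK hΛ ha s (fun j => srcComp_subset (hs6 j))
      (fun j => modeSum_ne_zero_of_mem_srcComp hK hΛ hua hadj (hs6 j))
    rw [Finset.sum_sub_distrib, arcCornerIdx_eq_cornerIdx, h2, Finset.sum_const, Finset.card_univ,
      Fintype.card_fin, nsmul_eq_mul]
    push_cast
    ring
  have hT : ∀ s ∈ (cornerSites (srcComp Λ va)).filter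
      (fun s => ∀ j : Fin 6, HexKernel.face s j ∈ srcComp Λ va),
      0 ≤ ∑ j : Fin 6, arg (modeSum (Fobs Λ s(ua, va)) (face s (j + 1)) /
          modeSum (Fobs Λ s(ua, va)) (face s j)) := by
    intro s hs
    have hs6 := (Finset.mem_filter.1 hs).2
    obtain ⟨n, hn⟩ := typedSum_nonneg_int hK hΛ ha s (fun j => srcComp_subset (hs6 j))
      (fun j => modeSum_ne_zero_of_mem_srcComp hK hΛ hua hadj (hs6 j))
    rw [hn]
    positivity
  -- (4): the boundary excess is non-negative
  have hbd := bdry_excess_nonneg hK hΛ hva hua hadj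
  -- (5): conclusion
  rw [Finset.sum_congr rfl hint] at hsplit
  have hle : ∑ s ∈ (cornerSites (srcComp Λ va)).filter
      (fun s => ∀ j : Fin 6, HexKernel.face s j ∈ srcComp Λ va),
      ∑ j : Fin 6, arg (modeSum (Fobs Λ s(ua, va)) (face s (j + 1)) /
          modeSum (Fobs Λ s(ua, va)) (face s j)) ≤ 0 := by
    linarith
  have hx_int : x ∈ (cornerSites (srcComp Λ va)).filter
      (fun s => ∀ j : Fin 6, HexKernel.face s j ∈ srcComp Λ va) :=
    Finset.mem_filter.2 ⟨mem_cornerSites_iff.2 ⟨0, hx0 0⟩, hx0⟩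
  exact (Finset.sum_eq_zero_iff_of_nonneg hT).1 (le_antisymm hle (Finset.sum_nonneg hT)) x hx_int

end NB

/-- **The registered stub `stub_noBranching` of line `eight_fifths_primitive`: the no-fold bound (K)
implies no branching of the developing map** — at every interior hexagon with non-degenerate
`∂H`-modes the typed sum `Σ_j arg (S_{j+1}/S_j)` vanishes (local degree one), by the combinatorial
Gauss–Bonnet count `NB.noBranching_of_noFoldBound`. -/
theorem stub_noBranching : NoFoldBound → NoBranching :=
  NB.noBranching_of_noFoldBound

end Summit.CriticalPhenomena.SAWScalingLimit.Cruxes.QCIdentification.EightFifthsPrimitive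

end
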